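import Literature.MathematicalPhysics.QuantumLattice.BoundedWilsonFlowLift
import Literature.MathematicalPhysics.QuantumLattice.TorusWilsonFlowExistence
import Literature.MathematicalPhysics.QuantumFieldTheory.LatticeGaugeProofs
import Literature.MathematicalPhysics.QuantumFieldTheory.YangMillsOS
import Mathlib
import HarnessLib

/-!
# Route `FlowLineStateSpace`, support ⟨stmt-QuantumFields-14707⟩ `EntropyNonConcentrationFromUI` — helper 1/3:
# translation covariance, continuity and boundedness of torus flow-line plaquette energies

For a faithful unitary lattice representation `r : LatticeRep G` and a family of TORUS WILSON FLOW LINES `B τ U` (in the sense of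
the item: `s ↦ (e ↦ ρ(B s U e))` is the matrix Wilson flow line of `e ↦ ρ(U e)` for the gauge set `H = range ρ`), on the discrete
torus `(ℤ/L)⁴`:
* `flow_torusConfigShift` — the flow commutes with lattice translations, `B τ (T_v U) = T_v (B τ U)` (uniqueness of flow lines on a
  finite lattice, tree `boundedMatrixWilsonFlow_translate` + `IsWilsonFlowLine.eq_matrixWilsonFlow`, and faithfulness of `ρ`);
* `plaqEnergy_torusConfigShift` — hence the flowed plaquette energy density
  `e(τ, x, U) = 2 Σ_{i<j} (N − Re tr ρ(U^{B τ U}_{x,ij}))` satisfies `e(τ, x, T_v U) = e(τ, x − v, U)`;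
* `integral_comp_plaqEnergy_eq` — so for the (translation-invariant) torus Wilson measure, `∫ f(e(τ,y,U)) dμ = ∫ f(e(τ,0,U)) dμ` for
  every `f : ℝ → ℝ` and every site `y` (tree `wilsonMeasure_map_torusConfigShift`, `integral_map_equiv`);
* `continuous_rho_flow`, `continuous_plaqEnergy`, `measurable_plaqEnergy` — `U ↦ e(τ, x, U)` is continuous (tree
  `continuousOn_matrixWilsonFlow` on unitary link fields) hence measurable;
* `plaqEnergy_nonneg`, `plaqEnergy_le` — `0 ≤ e ≤ 48 N` (`|Re tr| ≤ N` on `U(N)`).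

Mathlib + tree Wilson-flow library; THEOREMS ONLY (no definitions: the energy is written out as in the item); no named facts; no
`sorry`.  HONEST LABEL: bookkeeping for ONE support item of an open route; no crux, rung or summit is touched; the Yang–Mills mass gap
is NOT proved.  Width seat `ym-line-sfw-p2-w3` g34 (cell ym-idea-1, free hands; item leased 2026-08-29T04:26Z),
`--supports stmt-QuantumFields-14707`.
-/

set_option autoImplicit false

noncomputable section

namespace Summit.QuantumFields.YangMills.Theorems.FlowLineStateSpaceEntropy

open MeasureTheory
open scoped BigOperators Matrix
open Literature.MathematicalPhysics.QuantumLattice (IsWilsonFlowLine matrixWilsonFlow MatrixLinkField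
  boundedMatrixWilsonFlow_translate boundedMatrixWilsonFlow_eq_matrixWilsonFlow continuousOn_matrixWilsonFlow)
open Literature.MathematicalPhysics.QuantumFieldTheory

variable {G : Type} [Group G] [TopologicalSpace G] [IsTopologicalGroup G] [CompactSpace G]
  [MeasurableSpace G] [BorelSpace G]

omit [IsTopologicalGroup G] [CompactSpace G] [BorelSpace G] in
/-- **Translation covariance of torus flow lines.**  If `s ↦ ρ ∘ B s U` is the Wilson flow line of `ρ ∘ U` for every `U`, then
`B τ (T_v U) = T_v (B τ U)` for every lattice translation `T_v` of the torus (flow-line uniqueness on a finite lattice, tree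
`boundedMatrixWilsonFlow_translate`, and faithfulness of `ρ`). [cite: Luscher2010, §1 p. 2] -/
theorem flow_torusConfigShift (r : LatticeRep G) {L : ℕ} [NeZero L]
    (B : ℝ → GaugeConfig 4 L G → GaugeConfig 4 L G)
    (hB : ∀ U : GaugeConfig 4 L G,
      IsWilsonFlowLine (Set.range r.ρ) (fun e => r.ρ (U e)) (fun s e => r.ρ (B s U e)))
    (τ : ℝ) (v : Site 4 L) (U : GaugeConfig 4 L G) :
    B τ (torusConfigShift v U) = torusConfigShift v (B τ U) := by
  funext e
  apply r.injective
  have h1 : (fun e => r.ρ (B τ (torusConfigShift v U) e)) =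
      matrixWilsonFlow (Set.range r.ρ) τ (fun e => r.ρ (torusConfigShift v U e)) :=
    (hB (torusConfigShift v U)).eq_matrixWilsonFlow τ
  have h2 : (fun e => r.ρ (B τ U e)) = matrixWilsonFlow (Set.range r.ρ) τ (fun e => r.ρ (U e)) :=
    (hB U).eq_matrixWilsonFlow τ
  have h3 : (fun e => r.ρ (torusConfigShift v U e) : MatrixLinkField 4 (ZMod L) r.N) =
      (fun e => r.ρ (U e)) ∘ Prod.map (· + (-v)) id := by
    funext ⟨x, i⟩
    simp [torusConfigShift_apply, sub_eq_add_neg]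
  have h4 := boundedMatrixWilsonFlow_translate (Set.range r.ρ) τ
    (fun e => r.ρ (U e) : MatrixLinkField 4 (ZMod L) r.N) (-v)
  rw [boundedMatrixWilsonFlow_eq_matrixWilsonFlow, boundedMatrixWilsonFlow_eq_matrixWilsonFlow, ← h3, ← h1,
    ← h2] at h4
  have h5 := congrFun h4 e
  obtain ⟨x, i⟩ := e
  simpa [torusConfigShift_apply, sub_eq_add_neg] using h5

omit [IsTopologicalGroup G] [CompactSpace G] [BorelSpace G] in
/-- Flowed plaquette holonomies of a translated configuration are the translated flowed holonomies. [folklore] -/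
theorem plaquetteHolonomy_flow_torusConfigShift (r : LatticeRep G) {L : ℕ} [NeZero L]
    (B : ℝ → GaugeConfig 4 L G → GaugeConfig 4 L G)
    (hB : ∀ U : GaugeConfig 4 L G,
      IsWilsonFlowLine (Set.range r.ρ) (fun e => r.ρ (U e)) (fun s e => r.ρ (B s U e)))
    (τ : ℝ) (v : Site 4 L) (U : GaugeConfig 4 L G) (x : Site 4 L) (i j : Fin 4) :
    plaquetteHolonomy (B τ (torusConfigShift v U)) x i j = plaquetteHolonomy (B τ U) (x - v) i j := by
  rw [flow_torusConfigShift r B hB, plaquetteHolonomy_torusConfigShift]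

omit [IsTopologicalGroup G] [CompactSpace G] [BorelSpace G] in
/-- **Translation covariance of the flowed plaquette energy density** `e(τ, x, U) = 2 Σ_{i<j} (N − Re tr ρ(U^{BτU}_{x,ij}))`:
`e(τ, x, T_v U) = e(τ, x − v, U)`. [folklore] -/
theorem plaqEnergy_torusConfigShift (r : LatticeRep G) {L : ℕ} [NeZero L]
    (B : ℝ → GaugeConfig 4 L G → GaugeConfig 4 L G)
    (hB : ∀ U : GaugeConfig 4 L G,
      IsWilsonFlowLine (Set.range r.ρ) (fun e => r.ρ (U e)) (fun s e => r.ρ (B s U e)))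
    (τ : ℝ) (v : Site 4 L) (U : GaugeConfig 4 L G) (x : Site 4 L) :
    (2 * ∑ i : Fin 4, ∑ j : Fin 4, if i < j then
        ((r.N : ℝ) - (r.ρ (plaquetteHolonomy (B τ (torusConfigShift v U)) x i j)).trace.re) else 0 : ℝ) =
      2 * ∑ i : Fin 4, ∑ j : Fin 4, if i < j then
        ((r.N : ℝ) - (r.ρ (plaquetteHolonomy (B τ U) (x - v) i j)).trace.re) else 0 := by
  simp only [plaquetteHolonomy_flow_torusConfigShift r B hB]

/-- **Translation invariance of flowed one-site expectations** under the torus Wilson measure: for every site `y` and every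
`f : ℝ → ℝ`, `∫ f(e(τ, y, U)) dμ = ∫ f(e(τ, 0, U)) dμ` (translate by `−y`; the Wilson measure is translation invariant and the
flow is translation covariant). [folklore] -/
theorem integral_comp_plaqEnergy_eq (r : LatticeRep G) {L : ℕ} [NeZero L] (β : ℝ)
    (B : ℝ → GaugeConfig 4 L G → GaugeConfig 4 L G)
    (hB : ∀ U : GaugeConfig 4 L G,
      IsWilsonFlowLine (Set.range r.ρ) (fun e => r.ρ (U e)) (fun s e => r.ρ (B s U e)))
    (τ : ℝ) (y : Site 4 L) (f : ℝ → ℝ) :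
    ∫ U, f (2 * ∑ i : Fin 4, ∑ j : Fin 4, if i < j then
        ((r.N : ℝ) - (r.ρ (plaquetteHolonomy (B τ U) y i j)).trace.re) else 0) ∂(wilsonMeasure r.ρ β) =
      ∫ U, f (2 * ∑ i : Fin 4, ∑ j : Fin 4, if i < j then
        ((r.N : ℝ) - (r.ρ (plaquetteHolonomy (B τ U) 0 i j)).trace.re) else 0) ∂(wilsonMeasure r.ρ β) := by
  have h := integral_map_equiv (μ := wilsonMeasure (d := 4) (L := L) r.ρ β) (torusConfigShift (G := G) (-y))
    (fun U : GaugeConfig 4 L G => f (2 * ∑ i : Fin 4, ∑ j : Fin 4, if i < j then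
        ((r.N : ℝ) - (r.ρ (plaquetteHolonomy (B τ U) 0 i j)).trace.re) else 0))
  rw [wilsonMeasure_map_torusConfigShift] at h
  rw [h]
  refine integral_congr_ae (Filter.Eventually.of_forall fun U => ?_)
  simp only [plaquetteHolonomy_flow_torusConfigShift r B hB, zero_sub, neg_neg]

omit [IsTopologicalGroup G] [CompactSpace G] [MeasurableSpace G] [BorelSpace G] in
/-- **Continuity of the flowed links in the initial configuration**: `U ↦ ρ(B τ U e)` is continuous (tree
`continuousOn_matrixWilsonFlow` on unitary link fields; `ρ ∘ U` is unitary). [folklore] -/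
theorem continuous_rho_flow (r : LatticeRep G) {L : ℕ} [NeZero L]
    (B : ℝ → GaugeConfig 4 L G → GaugeConfig 4 L G)
    (hB : ∀ U : GaugeConfig 4 L G,
      IsWilsonFlowLine (Set.range r.ρ) (fun e => r.ρ (U e)) (fun s e => r.ρ (B s U e)))
    (τ : ℝ) (e : Edge 4 L) : Continuous fun U : GaugeConfig 4 L G => r.ρ (B τ U e) := by
  have hH : ∀ A ∈ Set.range r.ρ, A ∈ Matrix.unitaryGroup (Fin r.N) ℂ := by
    rintro _ ⟨g, rfl⟩
    exact r.mem_unitary g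
  have hc := continuousOn_matrixWilsonFlow (d := 4) (R := ZMod L) hH τ
  have hV : Continuous fun U : GaugeConfig 4 L G => (fun e => r.ρ (U e) : MatrixLinkField 4 (ZMod L) r.N) :=
    continuous_pi fun e => r.continuous.comp (continuous_apply e)
  have hmem : ∀ U : GaugeConfig 4 L G,
      (fun e => r.ρ (U e) : MatrixLinkField 4 (ZMod L) r.N) ∈
        {V : MatrixLinkField 4 (ZMod L) r.N | ∀ e, V e ∈ Matrix.unitaryGroup (Fin r.N) ℂ} :=
    fun U e => r.mem_unitary (U e)
  have h := hc.comp_continuous hV hmem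
  have hfun : (fun U : GaugeConfig 4 L G => r.ρ (B τ U e)) =
      fun U => matrixWilsonFlow (Set.range r.ρ) τ (fun e => r.ρ (U e) : MatrixLinkField 4 (ZMod L) r.N) e := by
    funext U
    exact congrFun ((hB U).eq_matrixWilsonFlow τ) e
  rw [hfun]
  exact (continuous_apply e).comp h

omit [IsTopologicalGroup G] [CompactSpace G] [MeasurableSpace G] [BorelSpace G] in
/-- `ρ` of a flowed plaquette holonomy, written with conjugate transposes (unitarity), is continuous in `U`. [folklore] -/
theorem continuous_rho_plaquetteHolonomy_flow (r : LatticeRep G) {L : ℕ} [NeZero L]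
    (B : ℝ → GaugeConfig 4 L G → GaugeConfig 4 L G)
    (hB : ∀ U : GaugeConfig 4 L G,
      IsWilsonFlowLine (Set.range r.ρ) (fun e => r.ρ (U e)) (fun s e => r.ρ (B s U e)))
    (τ : ℝ) (x : Site 4 L) (i j : Fin 4) :
    Continuous fun U : GaugeConfig 4 L G => r.ρ (plaquetteHolonomy (B τ U) x i j) := by
  have hinv : ∀ g : G, r.ρ g⁻¹ = (r.ρ g)ᴴ := fun g =>
    (Literature.MathematicalPhysics.QuantumLattice.conjTranspose_map_of_mem_unitaryGroup r.ρ r.mem_unitary g).symm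
  have hfun : (fun U : GaugeConfig 4 L G => r.ρ (plaquetteHolonomy (B τ U) x i j)) = fun U =>
      r.ρ (B τ U (x, i)) * r.ρ (B τ U (x.shift i, j)) * (r.ρ (B τ U (x.shift j, i)))ᴴ * (r.ρ (B τ U (x, j)))ᴴ := by
    funext U
    simp only [plaquetteHolonomy, map_mul, hinv]
  rw [hfun]
  exact (((continuous_rho_flow r B hB τ _).mul (continuous_rho_flow r B hB τ _)).mul
    (continuous_rho_flow r B hB τ _).matrix_conjTranspose).mul (continuous_rho_flow r B hB τ _).matrix_conjTranspose

omit [IsTopologicalGroup G] [CompactSpace G] [MeasurableSpace G] [BorelSpace G] in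
/-- **Continuity of the flowed plaquette energy density** `U ↦ e(τ, x, U)`. [folklore] -/
theorem continuous_plaqEnergy (r : LatticeRep G) {L : ℕ} [NeZero L]
    (B : ℝ → GaugeConfig 4 L G → GaugeConfig 4 L G)
    (hB : ∀ U : GaugeConfig 4 L G,
      IsWilsonFlowLine (Set.range r.ρ) (fun e => r.ρ (U e)) (fun s e => r.ρ (B s U e)))
    (τ : ℝ) (x : Site 4 L) :
    Continuous fun U : GaugeConfig 4 L G => (2 * ∑ i : Fin 4, ∑ j : Fin 4, if i < j then
        ((r.N : ℝ) - (r.ρ (plaquetteHolonomy (B τ U) x i j)).trace.re) else 0 : ℝ) := by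
  refine continuous_const.mul (continuous_finsetSum _ fun i _ => continuous_finsetSum _ fun j _ => ?_)
  split_ifs
  · refine continuous_const.sub ?_
    have htr : Continuous fun U : GaugeConfig 4 L G => (r.ρ (plaquetteHolonomy (B τ U) x i j)).trace := by
      simp only [Matrix.trace, Matrix.diag_apply]
      exact continuous_finsetSum _ fun k _ =>
        (continuous_apply_apply k k).comp (continuous_rho_plaquetteHolonomy_flow r B hB τ x i j)
    exact Complex.continuous_re.comp htr
  · exact continuous_const

omit [IsTopologicalGroup G] in
/-- **Measurability of the flowed plaquette energy density** (Borel, second-countable `G` via the faithful representation).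
[folklore] -/
theorem measurable_plaqEnergy (r : LatticeRep G) {L : ℕ} [NeZero L]
    (B : ℝ → GaugeConfig 4 L G → GaugeConfig 4 L G)
    (hB : ∀ U : GaugeConfig 4 L G,
      IsWilsonFlowLine (Set.range r.ρ) (fun e => r.ρ (U e)) (fun s e => r.ρ (B s U e)))
    (τ : ℝ) (x : Site 4 L) :
    Measurable fun U : GaugeConfig 4 L G => (2 * ∑ i : Fin 4, ∑ j : Fin 4, if i < j then
        ((r.N : ℝ) - (r.ρ (plaquetteHolonomy (B τ U) x i j)).trace.re) else 0 : ℝ) := by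
  haveI : SecondCountableTopology G :=
    (r.continuous.isClosedEmbedding r.injective).isEmbedding.secondCountableTopology
  exact (continuous_plaqEnergy r B hB τ x).measurable

/-- `|Re tr M| ≤ N` for unitary `M`. [folklore] -/
theorem abs_re_trace_le_of_unitary {N : ℕ} {M : Matrix (Fin N) (Fin N) ℂ}
    (hM : M ∈ Matrix.unitaryGroup (Fin N) ℂ) : |M.trace.re| ≤ N := by
  calc |M.trace.re| ≤ ‖M.trace‖ := Complex.abs_re_le_norm _
    _ = ‖∑ i, M i i‖ := rfl
    _ ≤ ∑ i, ‖M i i‖ := norm_sum_le _ _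
    _ ≤ ∑ _i : Fin N, (1 : ℝ) := Finset.sum_le_sum fun i _ => entry_norm_bound_of_unitary hM i i
    _ = N := by simp

omit [IsTopologicalGroup G] [CompactSpace G] [MeasurableSpace G] [BorelSpace G] in
/-- **The flowed plaquette energy density is non-negative** (`Re tr ρ(g) ≤ N` for unitary `ρ`). [folklore] -/
theorem plaqEnergy_nonneg (r : LatticeRep G) {L : ℕ} (V : GaugeConfig 4 L G) (x : Site 4 L) :
    0 ≤ (2 * ∑ i : Fin 4, ∑ j : Fin 4, if i < j then
        ((r.N : ℝ) - (r.ρ (plaquetteHolonomy V x i j)).trace.re) else 0 : ℝ) := by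
  refine mul_nonneg (by norm_num) (Finset.sum_nonneg fun i _ => Finset.sum_nonneg fun j _ => ?_)
  split_ifs
  · have := abs_re_trace_le_of_unitary (r.mem_unitary (plaquetteHolonomy V x i j))
    linarith [(abs_le.mp this).2]
  · exact le_rfl

omit [IsTopologicalGroup G] [CompactSpace G] [MeasurableSpace G] [BorelSpace G] in
/-- **The flowed plaquette energy density is bounded**: `e ≤ 64 N` (sixteen summands, each `≤ 2N`). [folklore] -/
theorem plaqEnergy_le (r : LatticeRep G) {L : ℕ} (V : GaugeConfig 4 L G) (x : Site 4 L) :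
    (2 * ∑ i : Fin 4, ∑ j : Fin 4, if i < j then
        ((r.N : ℝ) - (r.ρ (plaquetteHolonomy V x i j)).trace.re) else 0 : ℝ) ≤ 64 * r.N := by
  have hterm : ∀ i j : Fin 4, (if i < j then
      ((r.N : ℝ) - (r.ρ (plaquetteHolonomy V x i j)).trace.re) else 0 : ℝ) ≤ 2 * r.N := by
    intro i j
    split_ifs
    · have := abs_re_trace_le_of_unitary (r.mem_unitary (plaquetteHolonomy V x i j))
      linarith [(abs_le.mp this).1]
    · positivity
  have hsum : ∑ i : Fin 4, ∑ j : Fin 4, (if i < j then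
      ((r.N : ℝ) - (r.ρ (plaquetteHolonomy V x i j)).trace.re) else 0 : ℝ) ≤ ∑ _i : Fin 4, ∑ _j : Fin 4, (2 * r.N : ℝ) :=
    Finset.sum_le_sum fun i _ => Finset.sum_le_sum fun j _ => hterm i j
  simp only [Finset.sum_const, Finset.card_univ, Fintype.card_fin, nsmul_eq_mul, Nat.cast_ofNat] at hsum
  linarith

end Summit.QuantumFields.YangMills.Theorems.FlowLineStateSpaceEntropy

end
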